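import Mathlib
import Literature.NumberTheory.Transcendental.BlochWignerDerivative
import HarnessLib

/-!
# Functional equations of the Bloch–Wigner dilogarithm: duplication, triplication, five-term

Support file (everything PROVED; theorems only) for the discharge of
`Literature.NumberTheory.Transcendental.BaileyEtAl2010_sqrt7_identity`.

Method ("differentiate and use connectedness", Zagier 2007, Ch. I §§2–3): a real-valued
combination `x ↦ Σ nᵢ D(φᵢ(x))` of Bloch–Wigner values along rational maps `φᵢ` has real
derivative `h ↦ Im((Σ nᵢ c(φᵢ(x)) φᵢ'(x)) h)`, `c(z) = −log|1−z|/z − log|z|/(1−z)`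
(`HasDerivAt.blochWignerDilog_comp`); when `Σ nᵢ φᵢ ∧ (1 − φᵢ) = 0` the coefficient vanishes
identically, so the combination is constant on the complement of a finite set (connected), and the
constant is found at a real point, where `D` vanishes.

* `blochWignerDilog_sq` — `D(z²) = 2D(z) + 2D(−z)`;
* `blochWignerDilog_cube` — `D(z³) = 3(D(z) + D(ωz) + D(ω²z))` for `ω³ = 1`, `ω ≠ 1`;
* `blochWignerDilog_five_term` — `D(x) + D(y) + D((1−x)/(1−xy)) + D(1−xy) + D((1−y)/(1−xy)) = 0`
  (Zagier 2007, Ch. I §3, the five-term relation in its symmetric form).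

References: D. Zagier, *The dilogarithm function* (2007), Ch. I §2 (functional equations of
`Li₂`), §3 (those of `D`). All statements are [folklore].
-/

noncomputable section

open Set Metric Filter
open scoped Topology ComplexConjugate

namespace Literature.NumberTheory.Transcendental

/-! ### Linear bookkeeping for the functionals `h ↦ Im(c·h)` -/

/-- `imCLM ∘ ((c − d) • 1) = imCLM ∘ (c • 1) − imCLM ∘ (d • 1)`. [folklore] -/
theorem imCLM_comp_smul_sub (c d : ℂ) :
    Complex.imCLM.comp (ContinuousLinearMap.restrictScalars ℝ ((c - d) • (1 : ℂ →L[ℂ] ℂ))) =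
      Complex.imCLM.comp (ContinuousLinearMap.restrictScalars ℝ (c • (1 : ℂ →L[ℂ] ℂ))) -
        Complex.imCLM.comp (ContinuousLinearMap.restrictScalars ℝ (d • (1 : ℂ →L[ℂ] ℂ))) := by
  ext h; simp [sub_mul]

/-- `r • (imCLM ∘ (c • 1)) = imCLM ∘ ((r c) • 1)` for real `r` (orientation for collecting sums).
[folklore] -/
theorem smul_imCLM_comp_smul (r : ℝ) (c : ℂ) :
    r • Complex.imCLM.comp (ContinuousLinearMap.restrictScalars ℝ (c • (1 : ℂ →L[ℂ] ℂ))) =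
      Complex.imCLM.comp (ContinuousLinearMap.restrictScalars ℝ (((r : ℂ) * c) • (1 : ℂ →L[ℂ] ℂ))) :=
  (imCLM_comp_smul_real_mul r c).symm

/-! ### The ODE principle on the complement of a finite set -/

/-- If `F : ℂ → ℝ` has zero real derivative off a finite set `S`, then `F` is constant on `Sᶜ`
(the complement of a finite subset of the plane is connected). [folklore] -/
theorem apply_eq_of_hasFDerivAt_zero_off_finite {F : ℂ → ℝ} {S : Set ℂ} (hS : S.Finite)
    (hF : ∀ z, z ∉ S → HasFDerivAt F (0 : ℂ →L[ℝ] ℝ) z) {a b : ℂ} (ha : a ∉ S) (hb : b ∉ S) :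
    F a = F b := by
  have hUo : IsOpen Sᶜ := hS.isClosed.isOpen_compl
  have hUc : IsPreconnected Sᶜ :=
    (hS.countable.isConnected_compl_of_one_lt_rank
      (by simp only [Complex.rank_real_complex, Nat.one_lt_ofNat])).isPreconnected
  have hdiff : DifferentiableOn ℝ F Sᶜ := fun z hz =>
    (hF z hz).differentiableAt.differentiableWithinAt
  have hfd : Sᶜ.EqOn (fderiv ℝ F) 0 := fun z hz => (hF z hz).fderiv
  exact hUo.is_const_of_fderiv_eq_zero hUc hdiff hfd ha hb

/-! ### Duplication `D(z²) = 2D(z) + 2D(−z)` -/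

/-- The coefficient identity for the duplication relation. [folklore] -/
theorem bwc_sq_identity {w : ℂ} (h0 : w ≠ 0) (h1 : w ≠ 1) (h2 : w ≠ -1) :
    (-((Real.log ‖1 - w ^ 2‖ : ℝ) : ℂ) / w ^ 2 - ((Real.log ‖w ^ 2‖ : ℝ) : ℂ) / (1 - w ^ 2)) *
          (2 * w) -
        (2 : ℝ) * ((-((Real.log ‖1 - w‖ : ℝ) : ℂ) / w - ((Real.log ‖w‖ : ℝ) : ℂ) / (1 - w)) * 1) -
      (2 : ℝ) * ((-((Real.log ‖1 - -w‖ : ℝ) : ℂ) / (-w) - ((Real.log ‖-w‖ : ℝ) : ℂ) / (1 - -w)) *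
        (-1)) = 0 := by
  have h1' : (1 : ℂ) - w ≠ 0 := sub_ne_zero.2 (Ne.symm h1)
  have h2' : (1 : ℂ) + w ≠ 0 := by
    intro h; apply h2; linear_combination h
  have hn0 : ‖w‖ ≠ 0 := norm_ne_zero_iff.2 h0
  have hn1 : ‖(1 : ℂ) - w‖ ≠ 0 := norm_ne_zero_iff.2 h1'
  have hn2 : ‖(1 : ℂ) + w‖ ≠ 0 := norm_ne_zero_iff.2 h2'
  have e1 : Real.log ‖1 - w ^ 2‖ = Real.log ‖1 - w‖ + Real.log ‖1 + w‖ := by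
    rw [show (1 : ℂ) - w ^ 2 = (1 - w) * (1 + w) by ring, norm_mul, Real.log_mul hn1 hn2]
  have e2 : Real.log ‖w ^ 2‖ = 2 * Real.log ‖w‖ := by
    rw [norm_pow, Real.log_pow]; norm_num
  have e3 : Real.log ‖-w‖ = Real.log ‖w‖ := by rw [norm_neg]
  have e4 : Real.log ‖1 - -w‖ = Real.log ‖1 + w‖ := by rw [sub_neg_eq_add]
  rw [e1, e2, e3, e4]
  have h12 : (1 : ℂ) - w ^ 2 ≠ 0 := by
    rw [show (1 : ℂ) - w ^ 2 = (1 - w) * (1 + w) by ring]; exact mul_ne_zero h1' h2'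
  have h3 : (1 : ℂ) - -w ≠ 0 := by rwa [sub_neg_eq_add]
  push_cast
  field_simp
  ring

/-- **Duplication relation** `D(z²) = 2D(z) + 2D(−z)` for every `z ∈ ℂ` (Zagier 2007, Ch. I §2
"`Li₂(z²) = 2(Li₂(z) + Li₂(−z))`" and §3). [folklore] -/
theorem blochWignerDilog_sq (z : ℂ) :
    blochWignerDilog (z ^ 2) = 2 * blochWignerDilog z + 2 * blochWignerDilog (-z) := by
  let F : ℂ → ℝ := fun w =>
    blochWignerDilog (w ^ 2) - 2 * blochWignerDilog w - 2 * blochWignerDilog (-w)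
  let S : Set ℂ := {0, 1, -1}
  have hS : S.Finite := by simp [S]
  have hF : ∀ w, w ∉ S → HasFDerivAt F (0 : ℂ →L[ℝ] ℝ) w := by
    intro w hw
    simp only [S, mem_insert_iff, mem_singleton_iff, not_or] at hw
    obtain ⟨h0, h1, h2⟩ := hw
    have hsq0 : w ^ 2 ≠ 0 := pow_ne_zero 2 h0
    have hsq1 : w ^ 2 ≠ 1 := by
      intro h
      have : (w - 1) * (w + 1) = 0 := by linear_combination h
      rcases mul_eq_zero.1 this with h' | h'
      · exact h1 (by linear_combination h')
      · exact h2 (by linear_combination h')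
    have hn0 : -w ≠ 0 := neg_ne_zero.2 h0
    have hn1 : -w ≠ 1 := fun h => h2 (by linear_combination -h)
    have d1 := (HasDerivAt.blochWignerDilog_comp (by simpa using hasDerivAt_pow 2 w :
      HasDerivAt (fun y : ℂ => y ^ 2) (2 * w) w)) hsq0 hsq1
    have d2 := ((HasDerivAt.blochWignerDilog_comp (hasDerivAt_id w)) h0 h1).const_mul (2 : ℝ)
    have d3 := ((HasDerivAt.blochWignerDilog_comp (hasDerivAt_neg w)) hn0 hn1).const_mul (2 : ℝ)
    have d := (d1.sub d2).sub d3
    simp only [id, smul_imCLM_comp_smul, ← imCLM_comp_smul_sub] at d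
    refine d.congr_fderiv ?_
    rw [bwc_sq_identity h0 h1 h2, imCLM_comp_smul_zero]
  -- base point: a real number
  have hbase : F 2 = 0 := by
    simp only [F]
    rw [show (2 : ℂ) ^ 2 = ((4 : ℝ) : ℂ) by norm_num, show (2 : ℂ) = ((2 : ℝ) : ℂ) by norm_num,
      show -((2 : ℝ) : ℂ) = ((-2 : ℝ) : ℂ) by norm_num, blochWignerDilog_ofReal,
      blochWignerDilog_ofReal, blochWignerDilog_ofReal]
    ring
  have h2S : (2 : ℂ) ∉ S := by
    simp only [S, mem_insert_iff, mem_singleton_iff, not_or]; norm_num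
  by_cases hz : z ∈ S
  · -- the three exceptional points are real
    simp only [S, mem_insert_iff, mem_singleton_iff] at hz
    have h0 := blochWignerDilog_ofReal 0
    have h1 := blochWignerDilog_ofReal 1
    have hm1 := blochWignerDilog_ofReal (-1)
    push_cast at h0 h1 hm1
    rcases hz with rfl | rfl | rfl
    · simp [h0]
    · norm_num [h1, hm1]
    · norm_num [h1, hm1]
  · have := apply_eq_of_hasFDerivAt_zero_off_finite hS hF hz h2S
    rw [hbase] at this
    have : blochWignerDilog (z ^ 2) - 2 * blochWignerDilog z - 2 * blochWignerDilog (-z) = 0 := this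
    linarith

/-! ### Triplication `D(z³) = 3(D(z) + D(ωz) + D(ω²z))` -/

/-- `(1 − w)(1 − ωw)(1 − ω²w) = 1 − w³` for a primitive cube root of unity `ω`. [folklore] -/
theorem one_sub_cube_factor (w : ℂ) {ω : ℂ} (hs : ω ^ 2 + ω + 1 = 0) (h3 : ω ^ 3 = 1) :
    (1 - w) * (1 - ω * w) * (1 - ω ^ 2 * w) = 1 - w ^ 3 := by
  linear_combination (w ^ 2 - w) * hs + (w ^ 2 - w ^ 3) * h3

/-- The coefficient identity for the triplication relation. [folklore] -/
theorem bwc_cube_identity {w ω : ℂ} (hs : ω ^ 2 + ω + 1 = 0) (h3 : ω ^ 3 = 1) (h0 : w ≠ 0)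
    (h1 : w ≠ 1) (h1' : ω * w ≠ 1) (h1'' : ω ^ 2 * w ≠ 1) :
    (-((Real.log ‖1 - w ^ 3‖ : ℝ) : ℂ) / w ^ 3 - ((Real.log ‖w ^ 3‖ : ℝ) : ℂ) / (1 - w ^ 3)) *
            (3 * w ^ 2) -
          (3 : ℝ) * ((-((Real.log ‖1 - w‖ : ℝ) : ℂ) / w - ((Real.log ‖w‖ : ℝ) : ℂ) / (1 - w)) * 1) -
        (3 : ℝ) * ((-((Real.log ‖1 - ω * w‖ : ℝ) : ℂ) / (ω * w) -
          ((Real.log ‖ω * w‖ : ℝ) : ℂ) / (1 - ω * w)) * (ω * 1)) -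
      (3 : ℝ) * ((-((Real.log ‖1 - ω ^ 2 * w‖ : ℝ) : ℂ) / (ω ^ 2 * w) -
        ((Real.log ‖ω ^ 2 * w‖ : ℝ) : ℂ) / (1 - ω ^ 2 * w)) * (ω ^ 2 * 1)) = 0 := by
  have hω0 : ω ≠ 0 := by rintro rfl; norm_num at h3
  have hωn : ‖ω‖ = 1 := by
    have : ‖ω‖ ^ 3 = 1 := by rw [← norm_pow, h3, norm_one]
    exact (pow_eq_one_iff_of_nonneg (norm_nonneg ω) (by norm_num)).1 this
  have ha : (1 : ℂ) - w ≠ 0 := sub_ne_zero.2 (Ne.symm h1)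
  have hb : (1 : ℂ) - ω * w ≠ 0 := sub_ne_zero.2 (Ne.symm h1')
  have hc : (1 : ℂ) - ω ^ 2 * w ≠ 0 := sub_ne_zero.2 (Ne.symm h1'')
  have hb2 : (1 : ℂ) - w * ω ≠ 0 := by rwa [mul_comm] at hb
  have hc2 : (1 : ℂ) - w * ω ^ 2 ≠ 0 := by rwa [mul_comm] at hc
  have hfac := one_sub_cube_factor w hs h3
  have hP : (1 : ℂ) - w ^ 3 ≠ 0 := by rw [← hfac]; exact mul_ne_zero (mul_ne_zero ha hb) hc
  have e1 : Real.log ‖1 - w ^ 3‖ = Real.log ‖1 - w‖ + Real.log ‖1 - ω * w‖ +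
      Real.log ‖1 - ω ^ 2 * w‖ := by
    rw [← hfac, norm_mul, norm_mul, Real.log_mul (by positivity) (norm_ne_zero_iff.2 hc),
      Real.log_mul (norm_ne_zero_iff.2 ha) (norm_ne_zero_iff.2 hb)]
  have e2 : Real.log ‖w ^ 3‖ = 3 * Real.log ‖w‖ := by
    rw [norm_pow, Real.log_pow]; norm_num
  have e3 : Real.log ‖ω * w‖ = Real.log ‖w‖ := by rw [norm_mul, hωn, one_mul]
  have e4 : Real.log ‖ω ^ 2 * w‖ = Real.log ‖w‖ := by rw [norm_mul, norm_pow, hωn, one_pow, one_mul]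
  rw [e1, e2, e3, e4]
  push_cast
  field_simp
  linear_combination ((-3 : ℂ) * (Real.log ‖w‖ : ℂ) * w ^ 5 + (6 : ℂ) * (Real.log ‖w‖ : ℂ) * w ^ 4 +
      (-6 : ℂ) * (Real.log ‖w‖ : ℂ) * w ^ 2 + (3 : ℂ) * (Real.log ‖w‖ : ℂ) * w) * hs +
    ((-3 : ℂ) * (Real.log ‖w‖ : ℂ) * w ^ 5 + (9 : ℂ) * (Real.log ‖w‖ : ℂ) * w ^ 3 +
      (-6 : ℂ) * (Real.log ‖w‖ : ℂ) * w ^ 2) * h3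

/-- **Triplication relation** `D(z³) = 3(D(z) + D(ωz) + D(ω²z))` for every `z ∈ ℂ` and every
primitive cube root of unity `ω` (Zagier 2007, Ch. I §2, the distribution relation
`Li₂(zⁿ) = n Σ_{ωⁿ=1} Li₂(ωz)`, and §3). [folklore] -/
theorem blochWignerDilog_cube (z : ℂ) {ω : ℂ} (h3 : ω ^ 3 = 1) (hω : ω ≠ 1) :
    blochWignerDilog (z ^ 3) =
      3 * (blochWignerDilog z + blochWignerDilog (ω * z) + blochWignerDilog (ω ^ 2 * z)) := by
  have hs : ω ^ 2 + ω + 1 = 0 := by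
    have : (ω - 1) * (ω ^ 2 + ω + 1) = 0 := by linear_combination h3
    rcases mul_eq_zero.1 this with h | h
    · exact absurd (by linear_combination h) hω
    · exact h
  have hω0 : ω ≠ 0 := by rintro rfl; norm_num at h3
  have hω2 : ω ^ 2 ≠ 0 := pow_ne_zero 2 hω0
  let F : ℂ → ℝ := fun w => blochWignerDilog (w ^ 3) - 3 * blochWignerDilog w -
    3 * blochWignerDilog (ω * w) - 3 * blochWignerDilog (ω ^ 2 * w)
  let S : Set ℂ := {0, 1, ω, ω ^ 2}
  have hS : S.Finite := by simp [S]
  have hF : ∀ w, w ∉ S → HasFDerivAt F (0 : ℂ →L[ℝ] ℝ) w := by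
    intro w hw
    simp only [S, mem_insert_iff, mem_singleton_iff, not_or] at hw
    obtain ⟨h0, h1, h2, h4⟩ := hw
    have hc0 : w ^ 3 ≠ 0 := pow_ne_zero 3 h0
    have hfac := one_sub_cube_factor w hs h3
    have ha : (1 : ℂ) - w ≠ 0 := sub_ne_zero.2 (Ne.symm h1)
    have hb' : ω * w ≠ 1 := by
      intro h; apply h4; linear_combination (ω ^ 2) * h - w * h3
    have hc' : ω ^ 2 * w ≠ 1 := by
      intro h; apply h2; linear_combination ω * h - w * h3
    have hb : (1 : ℂ) - ω * w ≠ 0 := sub_ne_zero.2 (Ne.symm hb')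
    have hc : (1 : ℂ) - ω ^ 2 * w ≠ 0 := sub_ne_zero.2 (Ne.symm hc')
    have hc1 : w ^ 3 ≠ 1 := by
      intro h
      have : (1 - w) * (1 - ω * w) * (1 - ω ^ 2 * w) = 0 := by rw [hfac, h, sub_self]
      rcases mul_eq_zero.1 this with h' | h'
      · rcases mul_eq_zero.1 h' with h'' | h''
        · exact ha h''
        · exact hb h''
      · exact hc h'
    have hm0 : ω * w ≠ 0 := mul_ne_zero hω0 h0
    have hm0' : ω ^ 2 * w ≠ 0 := mul_ne_zero hω2 h0
    have d1 := (HasDerivAt.blochWignerDilog_comp (by simpa using hasDerivAt_pow 3 w :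
      HasDerivAt (fun y : ℂ => y ^ 3) (3 * w ^ 2) w)) hc0 hc1
    have d2 := ((HasDerivAt.blochWignerDilog_comp (hasDerivAt_id w)) h0 h1).const_mul (3 : ℝ)
    have d3 := ((HasDerivAt.blochWignerDilog_comp ((hasDerivAt_id w).const_mul ω)) hm0 hb').const_mul (3 : ℝ)
    have d4 := ((HasDerivAt.blochWignerDilog_comp ((hasDerivAt_id w).const_mul (ω ^ 2))) hm0' hc').const_mul
      (3 : ℝ)
    have d := ((d1.sub d2).sub d3).sub d4
    simp only [id, smul_imCLM_comp_smul, ← imCLM_comp_smul_sub] at d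
    refine d.congr_fderiv ?_
    rw [bwc_cube_identity hs h3 h0 h1 hb' hc', imCLM_comp_smul_zero]
  have hn : ‖ω‖ = 1 := by
    have : ‖ω‖ ^ 3 = 1 := by rw [← norm_pow, h3, norm_one]
    exact (pow_eq_one_iff_of_nonneg (norm_nonneg ω) (by norm_num)).1 this
  have h2S : (2 : ℂ) ∉ S := by
    simp only [S, mem_insert_iff, mem_singleton_iff, not_or]
    refine ⟨by norm_num, by norm_num, ?_, ?_⟩
    · intro h
      have : ‖(2 : ℂ)‖ = 1 := by rw [h, hn]
      norm_num at this
    · intro h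
      have : ‖(2 : ℂ)‖ = 1 := by rw [h, norm_pow, hn, one_pow]
      norm_num at this
  -- base value at the real point 2: D(8) = D(2) = 0 and D(2ω) + D(2ω²) = 0 by conjugation
  have hconj : ω ^ 2 = conj ω := by
    have hmul : ω * conj ω = 1 := by
      rw [Complex.mul_conj, Complex.normSq_eq_norm_sq, hn]; norm_num
    linear_combination -(ω ^ 2) * hmul + (conj ω) * h3
  have hbase : F 2 = 0 := by
    simp only [F]
    rw [show (2 : ℂ) ^ 3 = ((8 : ℝ) : ℂ) by norm_num, show (2 : ℂ) = ((2 : ℝ) : ℂ) by norm_num,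
      blochWignerDilog_ofReal, blochWignerDilog_ofReal, hconj,
      show conj ω * ((2 : ℝ) : ℂ) = conj (ω * ((2 : ℝ) : ℂ)) by rw [map_mul, Complex.conj_ofReal],
      blochWignerDilog_conj']
    ring
  by_cases hz : z ∈ S
  · -- the four exceptional points: all values are at real points or cancel by conjugation
    simp only [S, mem_insert_iff, mem_singleton_iff] at hz
    have h0 := blochWignerDilog_ofReal 0
    have h1 := blochWignerDilog_ofReal 1
    push_cast at h0 h1
    have hωω : blochWignerDilog (ω ^ 2) = -blochWignerDilog ω := by
      rw [hconj, blochWignerDilog_conj']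
    rcases hz with h | h | h | h <;> rw [h]
    · simp [h0]
    · simp only [one_pow, mul_one, h1, hωω]; ring
    · rw [h3, show ω * ω = ω ^ 2 by ring, show ω ^ 2 * ω = 1 by linear_combination h3, h1, hωω]
      ring
    · rw [show (ω ^ 2) ^ 3 = (ω ^ 3) ^ 2 by ring, h3, one_pow, show ω * ω ^ 2 = 1 by
        linear_combination h3, show ω ^ 2 * ω ^ 2 = ω by linear_combination ω * h3, h1, hωω]
      ring
  · have := apply_eq_of_hasFDerivAt_zero_off_finite hS hF hz h2S
    rw [hbase] at this
    have : blochWignerDilog (z ^ 3) - 3 * blochWignerDilog z - 3 * blochWignerDilog (ω * z) -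
      3 * blochWignerDilog (ω ^ 2 * z) = 0 := this
    linarith

/-! ### The five-term relation -/

/-- The coefficient identity for the five-term relation (derivative in `x`, `y` fixed): the
coefficient of `h ↦ Im(·h)` in `d/dx [D(x) + D(y) + D((1−x)/(1−xy)) + D(1−xy) + D((1−y)/(1−xy))]`
vanishes identically. [folklore] -/
theorem bwc_five_term_identity {x y : ℂ} (hx0 : x ≠ 0) (hx1 : x ≠ 1) (hy0 : y ≠ 0) (hy1 : y ≠ 1)
    (hxy : x * y ≠ 1) :
    (-((Real.log ‖1 - x‖ : ℝ) : ℂ) / x - ((Real.log ‖x‖ : ℝ) : ℂ) / (1 - x)) * 1 +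
          (-((Real.log ‖1 - (1 - x) / (1 - x * y)‖ : ℝ) : ℂ) / ((1 - x) / (1 - x * y)) -
              ((Real.log ‖(1 - x) / (1 - x * y)‖ : ℝ) : ℂ) / (1 - (1 - x) / (1 - x * y))) *
            ((-1 * (1 - x * y) - (1 - x) * -(1 * y)) / (1 - x * y) ^ 2) +
        (-((Real.log ‖1 - (1 - x * y)‖ : ℝ) : ℂ) / (1 - x * y) -
            ((Real.log ‖1 - x * y‖ : ℝ) : ℂ) / (1 - (1 - x * y))) * -(1 * y) +
      (-((Real.log ‖1 - (1 - y) / (1 - x * y)‖ : ℝ) : ℂ) / ((1 - y) / (1 - x * y)) -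
          ((Real.log ‖(1 - y) / (1 - x * y)‖ : ℝ) : ℂ) / (1 - (1 - y) / (1 - x * y))) *
        ((0 * (1 - x * y) - (1 - y) * -(1 * y)) / (1 - x * y) ^ 2) = 0 := by
  have ha : (1 : ℂ) - x ≠ 0 := sub_ne_zero.2 (Ne.symm hx1)
  have hb : (1 : ℂ) - y ≠ 0 := sub_ne_zero.2 (Ne.symm hy1)
  have hc : (1 : ℂ) - x * y ≠ 0 := sub_ne_zero.2 (Ne.symm hxy)
  have hc' : (1 : ℂ) - y * x ≠ 0 := by rwa [mul_comm] at hc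
  have e13 : 1 - (1 - x) / (1 - x * y) = x * (1 - y) / (1 - x * y) := by field_simp; ring
  have e15 : 1 - (1 - y) / (1 - x * y) = y * (1 - x) / (1 - x * y) := by field_simp; ring
  have e14 : (1 : ℂ) - (1 - x * y) = x * y := by ring
  have l3 : Real.log ‖(1 - x) / (1 - x * y)‖ = Real.log ‖1 - x‖ - Real.log ‖1 - x * y‖ := by
    rw [norm_div, Real.log_div (norm_ne_zero_iff.2 ha) (norm_ne_zero_iff.2 hc)]
  have l3' : Real.log ‖x * (1 - y) / (1 - x * y)‖ =
      Real.log ‖x‖ + Real.log ‖1 - y‖ - Real.log ‖1 - x * y‖ := by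
    rw [norm_div, norm_mul, Real.log_div (by positivity) (norm_ne_zero_iff.2 hc),
      Real.log_mul (norm_ne_zero_iff.2 hx0) (norm_ne_zero_iff.2 hb)]
  have l4 : Real.log ‖x * y‖ = Real.log ‖x‖ + Real.log ‖y‖ := by
    rw [norm_mul, Real.log_mul (norm_ne_zero_iff.2 hx0) (norm_ne_zero_iff.2 hy0)]
  have l5 : Real.log ‖(1 - y) / (1 - x * y)‖ = Real.log ‖1 - y‖ - Real.log ‖1 - x * y‖ := by
    rw [norm_div, Real.log_div (norm_ne_zero_iff.2 hb) (norm_ne_zero_iff.2 hc)]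
  have l5' : Real.log ‖y * (1 - x) / (1 - x * y)‖ =
      Real.log ‖y‖ + Real.log ‖1 - x‖ - Real.log ‖1 - x * y‖ := by
    rw [norm_div, norm_mul, Real.log_div (by positivity) (norm_ne_zero_iff.2 hc),
      Real.log_mul (norm_ne_zero_iff.2 hy0) (norm_ne_zero_iff.2 ha)]
  rw [e13, e15, e14, l3, l3', l4, l5, l5']
  push_cast
  field_simp
  ring

/-- The derivative step: for fixed `y ∉ {0, 1}`, the five-term combination has zero real
derivative in `x` at every `x ∉ {0, 1, 1/y}`. [folklore] -/
theorem hasFDerivAt_five_term_zero {y : ℂ} (hy0 : y ≠ 0) (hy1 : y ≠ 1) {x : ℂ} (hx0 : x ≠ 0)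
    (hx1 : x ≠ 1) (hxy : x * y ≠ 1) :
    HasFDerivAt (fun t : ℂ => blochWignerDilog t + blochWignerDilog y +
      blochWignerDilog ((1 - t) / (1 - t * y)) + blochWignerDilog (1 - t * y) +
      blochWignerDilog ((1 - y) / (1 - t * y))) (0 : ℂ →L[ℝ] ℝ) x := by
  have ha : (1 : ℂ) - x ≠ 0 := sub_ne_zero.2 (Ne.symm hx1)
  have hb : (1 : ℂ) - y ≠ 0 := sub_ne_zero.2 (Ne.symm hy1)
  have hc : (1 : ℂ) - x * y ≠ 0 := sub_ne_zero.2 (Ne.symm hxy)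
  -- the five maps and their derivatives
  have g1 : HasDerivAt (fun t : ℂ => t) 1 x := hasDerivAt_id x
  have g4 : HasDerivAt (fun t : ℂ => 1 - t * y) (-(1 * y)) x := (g1.mul_const y).const_sub 1
  have g3 : HasDerivAt (fun t : ℂ => (1 - t) / (1 - t * y))
      ((-1 * (1 - x * y) - (1 - x) * -(1 * y)) / (1 - x * y) ^ 2) x :=
    (g1.const_sub 1).div g4 hc
  have g5 : HasDerivAt (fun t : ℂ => (1 - y) / (1 - t * y))
      ((0 * (1 - x * y) - (1 - y) * -(1 * y)) / (1 - x * y) ^ 2) x :=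
    (hasDerivAt_const x (1 - y)).div g4 hc
  -- non-degeneracy of the arguments
  have h30 : (1 - x) / (1 - x * y) ≠ 0 := div_ne_zero ha hc
  have h31 : (1 - x) / (1 - x * y) ≠ 1 := by
    intro h
    rw [div_eq_one_iff_eq hc] at h
    have : x * (1 - y) = 0 := by linear_combination -h
    rcases mul_eq_zero.1 this with h' | h'
    · exact hx0 h'
    · exact hb h'
  have h40 : 1 - x * y ≠ 0 := hc
  have h41 : 1 - x * y ≠ 1 := by
    intro h
    have : x * y = 0 := by linear_combination -h
    rcases mul_eq_zero.1 this with h' | h'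
    · exact hx0 h'
    · exact hy0 h'
  have h50 : (1 - y) / (1 - x * y) ≠ 0 := div_ne_zero hb hc
  have h51 : (1 - y) / (1 - x * y) ≠ 1 := by
    intro h
    rw [div_eq_one_iff_eq hc] at h
    have : y * (1 - x) = 0 := by linear_combination -h
    rcases mul_eq_zero.1 this with h' | h'
    · exact hy0 h'
    · exact ha h'
  have d1 := (HasDerivAt.blochWignerDilog_comp g1) hx0 hx1
  have d2 : HasFDerivAt (fun _ : ℂ => blochWignerDilog y) (0 : ℂ →L[ℝ] ℝ) x :=
    hasFDerivAt_const _ x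
  have d3 := (HasDerivAt.blochWignerDilog_comp g3) h30 h31
  have d4 := (HasDerivAt.blochWignerDilog_comp g4) h40 h41
  have d5 := (HasDerivAt.blochWignerDilog_comp g5) h50 h51
  have d := (((d1.add d2).add d3).add d4).add d5
  simp only [add_zero, ← imCLM_comp_smul_add] at d
  refine d.congr_fderiv ?_
  rw [bwc_five_term_identity hx0 hx1 hy0 hy1 hxy, imCLM_comp_smul_zero]

/-- Constancy in `x`: for fixed `y ∉ {0, 1}` the five-term combination takes the same value at
any two points `a, b ∉ {0, 1, 1/y}`. [folklore] -/
theorem five_term_eq_of_not_mem {y : ℂ} (hy0 : y ≠ 0) (hy1 : y ≠ 1) {a b : ℂ}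
    (ha : a ∉ ({0, 1, y⁻¹} : Set ℂ)) (hb : b ∉ ({0, 1, y⁻¹} : Set ℂ)) :
    blochWignerDilog a + blochWignerDilog y + blochWignerDilog ((1 - a) / (1 - a * y)) +
        blochWignerDilog (1 - a * y) + blochWignerDilog ((1 - y) / (1 - a * y)) =
      blochWignerDilog b + blochWignerDilog y + blochWignerDilog ((1 - b) / (1 - b * y)) +
        blochWignerDilog (1 - b * y) + blochWignerDilog ((1 - y) / (1 - b * y)) := by
  have hS : ({0, 1, y⁻¹} : Set ℂ).Finite := by simp
  refine apply_eq_of_hasFDerivAt_zero_off_finite (F := fun t : ℂ => blochWignerDilog t +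
      blochWignerDilog y + blochWignerDilog ((1 - t) / (1 - t * y)) + blochWignerDilog (1 - t * y) +
      blochWignerDilog ((1 - y) / (1 - t * y))) hS ?_ ha hb
  intro x hx
  simp only [mem_insert_iff, mem_singleton_iff, not_or] at hx
  obtain ⟨hx0, hx1, hxy⟩ := hx
  have hxy' : x * y ≠ 1 := by
    intro h; apply hxy; exact eq_inv_of_mul_eq_one_left h
  exact hasFDerivAt_five_term_zero hy0 hy1 hx0 hx1 hxy'

/-- The five-term combination vanishes at real arguments (every value of `D` at a real point is
`0`). [folklore] -/
theorem five_term_ofReal (x y : ℝ) :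
    blochWignerDilog (x : ℂ) + blochWignerDilog (y : ℂ) +
        blochWignerDilog ((1 - (x : ℂ)) / (1 - (x : ℂ) * (y : ℂ))) +
        blochWignerDilog (1 - (x : ℂ) * (y : ℂ)) +
        blochWignerDilog ((1 - (y : ℂ)) / (1 - (x : ℂ) * (y : ℂ))) = 0 := by
  have e3 : (1 - (x : ℂ)) / (1 - (x : ℂ) * (y : ℂ)) = (((1 - x) / (1 - x * y) : ℝ) : ℂ) := by
    push_cast; rfl
  have e4 : (1 : ℂ) - (x : ℂ) * (y : ℂ) = ((1 - x * y : ℝ) : ℂ) := by push_cast; rfl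
  have e5 : (1 - (y : ℂ)) / (1 - (x : ℂ) * (y : ℂ)) = (((1 - y) / (1 - x * y) : ℝ) : ℂ) := by
    push_cast; rfl
  rw [e3, e5, e4]
  simp only [blochWignerDilog_ofReal, add_zero]

/-- **The five-term relation of the Bloch–Wigner dilogarithm** (Zagier 2007, Ch. I §3):
`D(x) + D(y) + D((1−x)/(1−xy)) + D(1−xy) + D((1−y)/(1−xy)) = 0` whenever the five arguments
avoid `{0, 1}`, i.e. `x, y ∉ {0, 1}` and `xy ≠ 1`. Proof: by `hasFDerivAt_five_term_zero` the
left side is locally constant in `x` off `{0, 1, 1/y}` (a connected set), by the symmetry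
`x ↔ y` also in `y`, and it vanishes when `x, y` are real. [folklore] -/
theorem blochWignerDilog_five_term {x y : ℂ} (hx0 : x ≠ 0) (hx1 : x ≠ 1) (hy0 : y ≠ 0)
    (hy1 : y ≠ 1) (hxy : x * y ≠ 1) :
    blochWignerDilog x + blochWignerDilog y + blochWignerDilog ((1 - x) / (1 - x * y)) +
        blochWignerDilog (1 - x * y) + blochWignerDilog ((1 - y) / (1 - x * y)) = 0 := by
  -- Step 1: real `y₁ ∈ (0,1)`, arbitrary admissible `x`.
  have step1 : ∀ (y₁ : ℝ), 0 < y₁ → y₁ < 1 → ∀ x : ℂ, x ≠ 0 → x ≠ 1 → x * y₁ ≠ 1 →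
      blochWignerDilog x + blochWignerDilog (y₁ : ℂ) +
        blochWignerDilog ((1 - x) / (1 - x * y₁)) + blochWignerDilog (1 - x * y₁) +
        blochWignerDilog ((1 - (y₁ : ℂ)) / (1 - x * y₁)) = 0 := by
    intro y₁ h0 h1 x hx0 hx1 hxy
    have hy0 : (y₁ : ℂ) ≠ 0 := by exact_mod_cast h0.ne'
    have hy1 : (y₁ : ℂ) ≠ 1 := by exact_mod_cast h1.ne
    have hx : x ∉ ({0, 1, (y₁ : ℂ)⁻¹} : Set ℂ) := by
      simp only [mem_insert_iff, mem_singleton_iff, not_or]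
      refine ⟨hx0, hx1, fun h => hxy ?_⟩
      rw [h, inv_mul_cancel₀ hy0]
    have hhalf : ((2⁻¹ : ℝ) : ℂ) ∉ ({0, 1, (y₁ : ℂ)⁻¹} : Set ℂ) := by
      simp only [mem_insert_iff, mem_singleton_iff, not_or]
      refine ⟨by norm_num, by norm_num, fun h => ?_⟩
      have h' : (2⁻¹ : ℝ) = y₁⁻¹ := by exact_mod_cast h
      have : y₁ = 2 := by simpa using (inv_inj.1 h').symm
      linarith
    rw [five_term_eq_of_not_mem hy0 hy1 hx hhalf]
    exact five_term_ofReal 2⁻¹ y₁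
  -- Step 2: real `x₁ ∈ (0,1)`, arbitrary admissible `y` (symmetry `x ↔ y`).
  have step2 : ∀ (x₁ : ℝ), 0 < x₁ → x₁ < 1 → ∀ y : ℂ, y ≠ 0 → y ≠ 1 → x₁ * y ≠ 1 →
      blochWignerDilog (x₁ : ℂ) + blochWignerDilog y +
        blochWignerDilog ((1 - (x₁ : ℂ)) / (1 - x₁ * y)) + blochWignerDilog (1 - x₁ * y) +
        blochWignerDilog ((1 - y) / (1 - x₁ * y)) = 0 := by
    intro x₁ h0 h1 y hy0 hy1 hxy
    have := step1 x₁ h0 h1 y hy0 hy1 (by rwa [mul_comm])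
    rw [mul_comm y (x₁ : ℂ)] at this
    linarith
  -- Step 3: general `y`, move `x` to a real point.
  obtain ⟨x₁, hx₁0, hx₁1, hx₁y⟩ : ∃ x₁ : ℝ, 0 < x₁ ∧ x₁ < 1 ∧ (x₁ : ℂ) * y ≠ 1 := by
    by_cases h : (2⁻¹ : ℂ) * y = 1
    · refine ⟨4⁻¹, by norm_num, by norm_num, fun h' => ?_⟩
      have hy : y = 2 := by linear_combination 2 * h
      rw [hy] at h'
      push_cast at h'
      norm_num at h'
    · exact ⟨2⁻¹, by norm_num, by norm_num, by push_cast; exact h⟩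
  have hx : x ∉ ({0, 1, y⁻¹} : Set ℂ) := by
    simp only [mem_insert_iff, mem_singleton_iff, not_or]
    refine ⟨hx0, hx1, fun h => hxy ?_⟩
    rw [h, inv_mul_cancel₀ hy0]
  have hx' : (x₁ : ℂ) ∉ ({0, 1, y⁻¹} : Set ℂ) := by
    simp only [mem_insert_iff, mem_singleton_iff, not_or]
    refine ⟨by exact_mod_cast hx₁0.ne', by exact_mod_cast hx₁1.ne, fun h => hx₁y ?_⟩
    rw [h, inv_mul_cancel₀ hy0]
  rw [five_term_eq_of_not_mem hy0 hy1 hx hx']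
  exact step2 x₁ hx₁0 hx₁1 y hy0 hy1 hx₁y

end Literature.NumberTheory.Transcendental
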